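import Summits.QuantumFields.BalabanUV.T4Continuum.Support.NE7K1LinBoxThm110
import Summits.QuantumFields.BalabanUV.T4Continuum.Support.NE7K1LinBoxLemma24
import Literature.MathematicalPhysics.QuantumFieldTheory.Balaban1983to89.B4Thm110ZeroBoxDeriv

/-!
# NE7K1LinBoxThm110DerivStep — row NE7 (node U5), candidate route HOM, path H1L, cell K1-lin(s): card §3y STEP 7, PART 6 —
# THE DERIVATIVE CLAUSE OF B4 (1.10) FOR THE TWO-CUTOFF LINE, STEP LAYER: the differenced block rows of `𝒢_j(s)` ((2.35), second
# quantity, for the line at every scale) and the differenced fluctuation term `Σ_{x′}L^k|(𝒢_{j+1}−𝒢_j)(xe,x′) − (𝒢_{j+1}−𝒢_j)(x,x′)|e^{δ₀|x−x′|∕L^k}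
# ≤ Θe^{δ₀}·L^{−(k−j)}`, SUMMABLE IN `j`, UNIFORMLY IN `s ∈ [0,1]`

Lineage `b2b-balaban-t4-ne7-p2` (CRUX PROVER NE7 #2), generation 79; file 99.  b04's `B4Thm110ZeroBoxDeriv` §3–§4 with `Gfine ↦ GfineL`
(the line's tower of files 95–97): the row-differenced, `L^k`-scaled recursion term is `α_j²·Σ_{y′,y} g(y)C_j(y,y′)B_j(y′,x′)` with
`g(y) = L^k(A_j(xe,y) − A_j(x,y))`, `|g(y)| ≤ s_j^{−1}C′e^{−κ|blk x−y|}` — ONE factor `s_j^{−2}` of the value estimate replaced by `s_j^{−1}`,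
the `(L^jη)^{1}` of [B4] (2.38)–(2.39) at `α = 0`.

* §1 **`GfineL_blockRowDiff_bound`** — (2.35), SECOND QUANTITY, FOR THE LINE at every scale, transported to the fine box:
  `|L^k·Σ_{x′ : blk_{b_j}x′ = y}(𝒢_j(s)(xe,x′) − 𝒢_j(s)(x,x′))| ≤ s_j^{−1}·C·e^{−κ|blk_{b_j}x − y|}` (file 82's `lemma24_line_235_second` =
  file 79's `boxResolventKernel_step_decay` in real form, constants in `(d, a₋(1−L^{−2}), a₊)` ONLY).
* §2 **`step_termD_bound_line`** — the differenced step bound, `(κ₀, Θ)` in `(d, ℓ, a₋, a₊)` ONLY (b04's generic `wsum_gCB_le`,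
  `exp_rate_mono`, `mul3_row_sub`, `wsum_mul_left` BY NAME).

HONEST FRAMING: [folklore]; A = 0; b04's proof text re-run with the line's inputs; nothing of Bałaban's asserted; no `sorry`.  Census
only (STEP 7, derivative clause, step layer); NE7 NOT PRINTED ∕ NOT PROVED; spine 0∕9; FIXED FINITE T⁴, rung (B)+1; NOT infinite volume,
NOT mass gap, NOT Clay.  HONEST DEPENDENCY: continuum YM on T⁴ ⇐ BetaPertH ∧ nine spine estimates (0/9 proved); BetaPertH ⇐ (D1) ∧
(D4) ∧ CAP+tail; G-an2-4 gates asym, D1 and NE2/3/4.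
-/

noncomputable section

open Finset Matrix

namespace Summit.QuantumFields.BalabanUV.T4Continuum.NE7K1LinBoxThm110DerivStep

open Literature.MathematicalPhysics.QuantumFieldTheory.Balaban1983to89
open Literature.MathematicalPhysics.QuantumFieldTheory.Balaban1983to89.B4Reflection242
open Literature.MathematicalPhysics.QuantumFieldTheory.Balaban1983to89.B4Lower18
open Literature.MathematicalPhysics.QuantumFieldTheory.Balaban1983to89.B4ContourShift (supNorm supNorm_nonneg)
open Literature.MathematicalPhysics.QuantumFieldTheory.Balaban1983to89.B4BoxCov237
open Literature.MathematicalPhysics.QuantumFieldTheory.Balaban1983to89.B4Thm110ZeroBox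
open Literature.MathematicalPhysics.QuantumFieldTheory.Balaban1983to89.B4Thm110ZeroBoxDeriv
open Literature.MathematicalPhysics.QuantumFieldTheory.Balaban1983to89.B4Sect5Proof (latticeConst latticeConst_nonneg latticeSum_le)
open NE7K1LinSchurLineU1 NE7K1LinSchurFoldBox NE7K1LinBoxCovEnergy NE7K1LinLineLaplacian NE7K1LinBoxCov237 NE7K1LinBoxScales
open NE7K1LinBoxRGStep NE7K1LinBoxThm110Step NE7K1LinBoxLemma24

variable {d : ℕ}

/-! ### §1 Transport of the block-row DERIVATIVE decay (2.35) for the line to the fine box -/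

/-- **DIFFERENCED BLOCK-ROW SUMS OF `𝒢_j(s)` DECAY** — the derivative half of (2.35) for the line in block-row form (file 82's
`lemma24_line_235_second`, i.e. file 79's `boxResolventKernel_step_decay`), transported to the fine box with `L^k = s_jb_j`: for lattice
neighbours `xe = x + e_μ`, `|L^k·Σ_{x′ : blk_{b_j}x′ = y}(𝒢_j(s)(xe,x′) − 𝒢_j(s)(x,x′))| ≤ s_j^{-1}·C·e^{−κ|blk_{b_j}x − y|}`, ONE pair `(κ, C)` in
`(d, ℓ, a₋, a₊)` for every `k`, `j`, `a ∈ [a₋,a₊]`, `s ∈ [0,1]`, box. [cite: Balaban1983RegularityDecay, p. 582 Lemma 2.4 (2.35),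
for the two-cutoff line] -/
theorem GfineL_blockRowDiff_bound (d ℓ : ℕ) (hℓ : 1 ≤ ℓ) (aminus aplus : ℝ) (ha : 0 < aminus) :
    ∃ κ C : ℝ, 0 < κ ∧ 0 ≤ C ∧ ∀ (k j : ℕ), 1 ≤ j → ∀ (hj : j + 1 ≤ k), ∀ (a s : ℝ), aminus ≤ a → a ≤ aplus →
      0 ≤ s → s ≤ 1 → ∀ (M : Fin (d + 1) → ℕ), (∀ i, 1 ≤ M i) →
        ∀ (μ : Fin (d + 1)) (x xe : ↥(boxDom (Nf ℓ k M))), xe.1 = x.1 + Pi.single μ 1 →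
        ∀ (y : Fin (d + 1) → ℤ), y ∈ boxDom (Mj ℓ k M j) →
          |((((ℓ + 1) ^ k : ℕ)) : ℝ) * ∑ x' : ↥(boxDom (Nf ℓ k M)),
              (if blk (bj ℓ j) x'.1 = y then GfineL ℓ k M j a s xe x' - GfineL ℓ k M j a s x x' else 0)|
            ≤ (sc ℓ k j)⁻¹ * C * Real.exp (-(κ * supNorm (blk (bj ℓ j) x.1 - y))) := by
  set amin' : ℝ := aminus * (1 - ((((ℓ : ℝ) + 1)) ^ 2)⁻¹) with hamin'
  have ha' : 0 < amin' := aminus'_pos hℓ ha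
  obtain ⟨κ, C, hκ, hC, h⟩ := lemma24_line_235_second d amin' aplus ha'
  refine ⟨κ, C, hκ, hC.le, fun k j hj1 hj a s h1 h2 h3 h4 M hM μ x xe hxe y hy => ?_⟩
  have ha0 : 0 < a := lt_of_lt_of_le ha h1
  obtain ⟨hw1, hw2, hapos⟩ := aSeq_window hℓ ha h1 h2 hj1
  have hs : 0 < sc ℓ k j ^ 2 := pow_pos (sc_pos ℓ k j) 2
  have hsc0 : sc ℓ k j ≠ 0 := (sc_pos ℓ k j).ne'
  have hxe' : ((ej ℓ k M j hj).symm xe).1 = ((ej ℓ k M j hj).symm x).1 + B4Green244.e μ := hxe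
  have hrow := h (bj ℓ j) (bj_pos ℓ j) (ℓ + 1) inferInstance _ s hw1 hw2 h3 h4 (Mj ℓ k M j) (Mj_pos hM) μ
    ((ej ℓ k M j hj).symm x) ((ej ℓ k M j hj).symm xe) hxe' ⟨y, hy⟩
  have hxv : ((ej ℓ k M j hj).symm x).1 = x.1 := rfl
  rw [hxv, Finset.sum_filter, Finset.sum_filter, ← Finset.sum_sub_distrib, abs_mul, Nat.abs_cast] at hrow
  have hsum : ∑ x' : ↥(boxDom (Nf ℓ k M)),
      (if blk (bj ℓ j) x'.1 = y then GfineL ℓ k M j a s xe x' - GfineL ℓ k M j a s x x' else 0)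
      = (sc ℓ k j ^ 2)⁻¹ * ∑ z : ↥(boxDom (fun i => bj ℓ j * Mj ℓ k M j i)),
          ((if blk (bj ℓ j) z.1 = y then
              (boxLine (ℓ + 1) (bj_pos ℓ j) (Mj ℓ k M j) (B1.aSeq a ((ℓ : ℝ) + 1) j) s)⁻¹ ((ej ℓ k M j hj).symm xe) z else 0)
            - (if blk (bj ℓ j) z.1 = y then
              (boxLine (ℓ + 1) (bj_pos ℓ j) (Mj ℓ k M j) (B1.aSeq a ((ℓ : ℝ) + 1) j) s)⁻¹ ((ej ℓ k M j hj).symm x) z else 0)) := by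
    rw [sum_Nf_eq_sum_ej hj, Finset.mul_sum]
    refine Finset.sum_congr rfl fun z _ => ?_
    have hzv : (ej ℓ k M j hj z).1 = z.1 := rfl
    rw [hzv]
    split_ifs with hz
    · rw [GfineL_apply hℓ hj1 hj hM ha0 h3 h4, GfineL_apply hℓ hj1 hj hM ha0 h3 h4, Equiv.symm_apply_apply, mul_sub]
    · rw [sub_zero, mul_zero]
  have hnR : ((((ℓ + 1) ^ k : ℕ)) : ℝ) = sc ℓ k j * ((bj ℓ j : ℕ) : ℝ) := by
    rw [sc_mul_bj (by omega : j ≤ k)]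
    push_cast
    ring
  have heq : ∀ S : ℝ, (((ℓ + 1) ^ k : ℕ) : ℝ) * ((sc ℓ k j ^ 2)⁻¹ * S)
      = (sc ℓ k j)⁻¹ * (((bj ℓ j : ℕ) : ℝ) * S) := by
    intro S
    rw [hnR]
    field_simp
  rw [hsum, heq, abs_mul, abs_of_pos (inv_pos.2 (sc_pos ℓ k j)), abs_mul, Nat.abs_cast, mul_assoc]
  exact mul_le_mul_of_nonneg_left hrow (inv_pos.2 (sc_pos ℓ k j)).le

/-! ### §2 The differenced fluctuation term of one renormalization step of the line

With `A_j = 𝒢_jQ_j^*`, `B_j = Q_j𝒢_j`, `C_j = s_j^{-2}C^{(j)}(□)` and `𝒢_{j+1} − 𝒢_j = α_j²·A_jC_jB_j`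
(file 97's `GfineL_succ_sub`, the (2.34) recursion for the line), the row-differenced and `L^k`-scaled term is
`α_j²·Σ_{y′,y} g(y)C_j(y,y′)B_j(y′,x′)` with `g(y) = L^k(A_j(xe,y) − A_j(x,y))`, `|g(y)| ≤ s_j^{-1}C′e^{−κ|blk x−y|}` (§1):
ONE factor `s_j^{-2}` of the value estimate is replaced by `s_j^{-1}` — exactly the `(L^jη)^{1}` of [B4] (2.38)–(2.39)
at `α = 0` — and the step is still summable: `≤ Θe^{δ₀}·L^{-(k-j)}`. -/

section StepBound

variable {ℓ k j : ℕ} {M : Fin (d + 1) → ℕ} {a s : ℝ}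

set_option maxHeartbeats 1600000 in
/-- **THE DIFFERENCED STEP BOUND FOR THE LINE**: there are `κ₀ > 0`, `Θ ≥ 0` (depending on `d, ℓ` and the window `[a₋,a₊]`
only) such that for every weight rate `0 ≤ δ₀ ≤ κ₀`, every `1 ≤ j < k`, every `a` of the window, EVERY `s ∈ [0,1]`, every box
and every pair of lattice neighbours `xe = x + e_μ` of the fine box:
`Σ_{x′} L^k|(𝒢_{j+1}(s) − 𝒢_j(s))(xe,x′) − (𝒢_{j+1}(s) − 𝒢_j(s))(x,x′)|·e^{δ₀|x−x′|_∞/L^k} ≤ Θe^{δ₀}·L^{-(k-j)}` — b04's `step_termD_bound`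
re-run with the line's (2.35) (both quantities; files 95 ∕ 82) and (2.37) (file 81). [cite: Balaban1983RegularityDecay, p. 582
(2.34)–(2.35), (2.38)–(2.39), for the two-cutoff line] -/
theorem step_termD_bound_line (d ℓ : ℕ) (hℓ : 1 ≤ ℓ) (amin aplus : ℝ) (ha : 0 < amin) :
    ∃ κ₀ Θ : ℝ, 0 < κ₀ ∧ 0 ≤ Θ ∧ ∀ (δ₀ : ℝ), 0 ≤ δ₀ → δ₀ ≤ κ₀ →
      ∀ (k j : ℕ), 1 ≤ j → ∀ (hj : j + 1 ≤ k), ∀ (a s : ℝ), amin ≤ a → a ≤ aplus → 0 ≤ s →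
        s ≤ 1 → ∀ (M : Fin (d + 1) → ℕ), (∀ i, 1 ≤ M i) →
        ∀ (μ : Fin (d + 1)) (x xe : ↥(boxDom (Nf ℓ k M))), xe.1 = x.1 + Pi.single μ 1 →
          wsum δ₀ ((ℓ + 1) ^ k) x (fun x' => (((ℓ + 1) ^ k : ℕ) : ℝ) *
              ((GfineL ℓ k M (j + 1) a s - GfineL ℓ k M j a s) xe x'
                - (GfineL ℓ k M (j + 1) a s - GfineL ℓ k M j a s) x x'))
            ≤ Θ * Real.exp δ₀ * (sc ℓ k j)⁻¹ := by
  obtain ⟨κ, C₁, hκ, hC₁, hR⟩ := GfineL_blockRow_bound d ℓ hℓ amin aplus ha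
  obtain ⟨κ', C', hκ', hC', hDf⟩ := GfineL_blockRowDiff_bound d ℓ hℓ amin aplus ha
  obtain ⟨δ, c₂, hδ, hc₂, hCov⟩ := cov237S_box_decay d ℓ hℓ (amin * (1 - ((((ℓ : ℝ) + 1)) ^ 2)⁻¹)) aplus
    amin aplus (aminus'_pos hℓ ha) ha (ℓ + 1)
  have hK0 : ∀ t : ℝ, 0 < t → 0 ≤ latticeConst (d + 1) t := fun t ht => latticeConst_nonneg _ ht.le
  have hκ₁ : 0 < min κ κ' := lt_min hκ hκ'
  have hKκ := hK0 _ (half_pos hκ₁)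
  have hKδ := hK0 _ (half_pos hδ)
  refine ⟨min (min κ κ') δ / 2, aplus ^ 2 * (C' * c₂ * C₁)
      * (latticeConst (d + 1) (min κ κ' / 2) * latticeConst (d + 1) (δ / 2)
          * latticeConst (d + 1) (min κ κ' / 2)),
    by positivity, ?_, ?_⟩
  · exact mul_nonneg (mul_nonneg (sq_nonneg _) (mul_nonneg (mul_nonneg hC' hc₂.le) hC₁))
      (mul_nonneg (mul_nonneg hKκ hKδ) hKκ)
  intro δ₀ hδ0 hδ1 k j hj1 hj a s h1 h2 h3 h4 M hM μ x xe hxe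
  have ha0 : 0 < a := lt_of_lt_of_le ha h1
  obtain ⟨hw1, hw2, hapos⟩ := aSeq_window hℓ ha h1 h2 hj1
  have hs : 0 < sc ℓ k j ^ 2 := pow_pos (sc_pos ℓ k j) 2
  have hsi : 0 < (sc ℓ k j ^ 2)⁻¹ := inv_pos.2 hs
  have hs1i : 0 < (sc ℓ k j)⁻¹ := inv_pos.2 (sc_pos ℓ k j)
  have hsc0 : sc ℓ k j ≠ 0 := (sc_pos ℓ k j).ne'
  have hb1 : 1 ≤ bj ℓ j := bj_pos ℓ j
  have hbD : (0 : ℝ) < ((bj ℓ j : ℕ) : ℝ) ^ (d + 1) := by positivity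
  have hδκ : δ₀ ≤ min κ κ' / 2 := hδ1.trans (by linarith [min_le_left (min κ κ') δ])
  have hδδ : δ₀ ≤ δ / 2 := hδ1.trans (by linarith [min_le_right (min κ κ') δ])
  -- the differenced block-row vector `g(y) = L^k(A_j(xe,y) − A_j(x,y))`
  have hg : ∀ y : ↥(boxDom (Mj ℓ k M j)),
      |(((ℓ + 1) ^ k : ℕ) : ℝ) * (AmatL ℓ k M j a s xe y - AmatL ℓ k M j a s x y)|
        ≤ (sc ℓ k j)⁻¹ * C' * Real.exp (-(min κ κ' * supNorm (blk (bj ℓ j) x.1 - y.1))) := by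
    intro y
    have hAd : AmatL ℓ k M j a s xe y - AmatL ℓ k M j a s x y
        = ∑ x', (if blk (bj ℓ j) x'.1 = y.1 then
            GfineL ℓ k M j a s xe x' - GfineL ℓ k M j a s x x' else 0) := by
      simp only [AmatL, Matrix.mul_apply, QksM, Matrix.of_apply, mul_ite, mul_one, mul_zero]
      rw [← Finset.sum_sub_distrib]
      refine Finset.sum_congr rfl fun x' _ => ?_
      split_ifs <;> ring
    rw [hAd]
    exact (hDf k j hj1 hj a s h1 h2 h3 h4 M hM μ x xe hxe y.1 y.2).trans
      (mul_le_mul_of_nonneg_left (exp_rate_mono (min_le_right κ κ') (supNorm_nonneg _))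
        (mul_nonneg hs1i.le hC'))
  have hB : ∀ (y' : ↥(boxDom (Mj ℓ k M j))) (x' : ↥(boxDom (Nf ℓ k M))),
      |BmatL ℓ k M j a s y' x'| ≤ ((((bj ℓ j : ℕ) : ℝ)) ^ (d + 1))⁻¹ *
        ((sc ℓ k j ^ 2)⁻¹ * C₁ * Real.exp (-(min κ κ' * supNorm (blk (bj ℓ j) x'.1 - y'.1)))) := by
    intro y' x'
    have hBe : BmatL ℓ k M j a s y' x' = ((((bj ℓ j : ℕ) : ℝ)) ^ (d + 1))⁻¹ *
        ∑ w, (if blk (bj ℓ j) w.1 = y'.1 then GfineL ℓ k M j a s x' w else 0) := by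
      simp only [BmatL, Matrix.mul_apply, QkM, Matrix.of_apply, Finset.mul_sum]
      refine Finset.sum_congr rfl fun w _ => ?_
      split_ifs with hw
      · rw [(GfineL_isSymm ℓ k M j a s).apply x' w]
      · rw [zero_mul, mul_zero]
    rw [hBe, abs_mul, abs_of_pos (inv_pos.2 hbD)]
    refine mul_le_mul_of_nonneg_left ?_ (inv_pos.2 hbD).le
    exact (hR k j hj1 hj a s h1 h2 h3 h4 M hM x' y'.1 y'.2).trans
      (mul_le_mul_of_nonneg_left (exp_rate_mono (min_le_left κ κ') (supNorm_nonneg _))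
        (mul_nonneg hsi.le hC₁))
  have hC : ∀ (y y' : ↥(boxDom (Mj ℓ k M j))),
      |CmatL ℓ k M j a s y y'| ≤ (sc ℓ k j ^ 2)⁻¹ * c₂ * Real.exp (-(δ * supNorm (y.1 - y'.1))) := by
    intro y y'
    have h := (hCov (bj ℓ j) hb1 _ a s hw1 hw2 h1 h2 h3 h4 (Mp ℓ k M j) (Mp_pos hM)).2 y y'
    rw [CmatL, Matrix.smul_apply, smul_eq_mul, abs_mul, abs_of_pos hsi, mul_assoc]
    exact mul_le_mul_of_nonneg_left h hsi.le
  -- the triple-product estimate of §2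
  have htri := wsum_gCB_le hj M x
    (fun y => (((ℓ + 1) ^ k : ℕ) : ℝ) * (AmatL ℓ k M j a s xe y - AmatL ℓ k M j a s x y))
    (CmatL ℓ k M j a s) (BmatL ℓ k M j a s)
    (mul_nonneg hs1i.le hC') (mul_nonneg hsi.le hc₂.le) (mul_nonneg hsi.le hC₁) hκ₁ hδ hδ0 hδκ hδδ hg hC hB
  -- `L^k·(differenced row of α_j²A_jC_jB_j) = α_j²·Σ_{y′,y} g C_j B_j`
  have hfun : (fun x' => (((ℓ + 1) ^ k : ℕ) : ℝ) *
        ((GfineL ℓ k M (j + 1) a s - GfineL ℓ k M j a s) xe x'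
          - (GfineL ℓ k M (j + 1) a s - GfineL ℓ k M j a s) x x'))
      = fun x' => αj a ℓ k j ^ 2 * ∑ y', ∑ y,
          (((ℓ + 1) ^ k : ℕ) : ℝ) * (AmatL ℓ k M j a s xe y - AmatL ℓ k M j a s x y)
            * CmatL ℓ k M j a s y y' * BmatL ℓ k M j a s y' x' := by
    funext x'
    rw [GfineL_succ_sub hℓ hj1 hj hM ha0 h3 h4, Matrix.smul_apply, Matrix.smul_apply, smul_eq_mul, smul_eq_mul,
      ← mul_sub, mul_left_comm, mul3_row_sub]
  have hα : αj a ℓ k j ^ 2 ≤ aplus ^ 2 * (sc ℓ k j ^ 2) ^ 2 := by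
    unfold αj
    rw [mul_pow]
    exact mul_le_mul_of_nonneg_right (pow_le_pow_left₀ hapos.le hw2 2) (by positivity)
  rw [hfun, wsum_mul_left _ _ _ (sq_nonneg _)]
  calc αj a ℓ k j ^ 2 * wsum δ₀ ((ℓ + 1) ^ k) x (fun x' => ∑ y', ∑ y,
          (((ℓ + 1) ^ k : ℕ) : ℝ) * (AmatL ℓ k M j a s xe y - AmatL ℓ k M j a s x y)
            * CmatL ℓ k M j a s y y' * BmatL ℓ k M j a s y' x')
      ≤ (aplus ^ 2 * (sc ℓ k j ^ 2) ^ 2) *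
          ((sc ℓ k j)⁻¹ * C' * ((sc ℓ k j ^ 2)⁻¹ * c₂) * ((sc ℓ k j ^ 2)⁻¹ * C₁) * Real.exp δ₀
          * (latticeConst (d + 1) (min κ κ' / 2) * latticeConst (d + 1) (δ / 2)
              * latticeConst (d + 1) (min κ κ' / 2))) :=
        mul_le_mul hα htri (wsum_nonneg _ _ _ _) (by positivity)
    _ = aplus ^ 2 * (C' * c₂ * C₁)
          * (latticeConst (d + 1) (min κ κ' / 2) * latticeConst (d + 1) (δ / 2)
              * latticeConst (d + 1) (min κ κ' / 2))
          * Real.exp δ₀ * (sc ℓ k j)⁻¹ := by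
        field_simp

end StepBound


end Summit.QuantumFields.BalabanUV.T4Continuum.NE7K1LinBoxThm110DerivStep

end
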